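import Literature.Algebra.Homology.GroupCohomologySemilinearKernel
import HarnessLib

/-!
# `Hⁿ(s)` is surjective when `H^{n+1}` of the kernel vanishes

Topic `Algebra/Homology`; namespace `Literature.Algebra.Homology`; theorems only, continuing
`GroupCohomologySemilinearKernel`.  Exactness at `Hⁿ(G, B)` of the long exact sequence of a short
exact sequence of coefficients `0 → C →t A →s B → 0` in the SEMILINEAR setting (`s` semilinear over
`σ : k → k'`, `t` linear), in the form that avoids the connecting homomorphism:

* **`semimap_surjective_of_subsingleton`** — if `H^{n+1}(G, C) = 0` then
  `Hⁿ(s) : Hⁿ(G, A) → Hⁿ(G, B)` is surjective (diagram chase on inhomogeneous cochains: lift a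
  cocycle of `B` to a cochain `a` of `A`; `da` takes values in `ker s = t(C)` and is `t` of a cocycle
  of `C`, a coboundary `dc'` by hypothesis; `a − t c'` is a cocycle lifting the class);
* **`semimap_smul_id_surjective_of_subsingleton`** — the case `C = A`, `t = ϖ · id` (reduction of a
  `ϖ`-torsion-free lattice modulo `ϖ`): `Hⁿ(G, A) → Hⁿ(G, A/ϖ)` is surjective when
  `H^{n+1}(G, A) = 0` — the step "`H² → H²(mod pⁿ)` is onto above the cohomological dimension" of
  Hida's control theorem ([Hida1994AIF, §3]; [KhareThorne2017, §6.4]).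

[Brown1982CohomologyGroups, III.6 Prop. 6.1 (long exact sequence)]

## References

* K. S. Brown, *Cohomology of Groups*, GTM 87 (1982), III.6 (held). [Brown1982CohomologyGroups]
* H. Hida, Ann. Inst. Fourier 44 (1994), §3 (held). [Hida1994AIF]
-/

noncomputable section

open CategoryTheory groupCohomology

namespace Literature.Algebra.Homology

universe u

variable {k k' : Type u} [CommRing k] [CommRing k'] {G : Type u} [Group G]
variable {σ : k →+* k'} {C A : Rep k G} {B : Rep k' G}

/-- `d ∘ d = 0` on inhomogeneous cochains, pointwise. [folklore] -/
theorem inhomogeneousCochains_d_d_apply (n : ℕ) (a : (inhomogeneousCochains A).X n) :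
    inhomogeneousCochains.d A (n + 1) (inhomogeneousCochains.d A n a) = 0 := by
  have h := LinearMap.congr_fun (congrArg ModuleCat.Hom.hom ((inhomogeneousCochains A).d_comp_d n (n + 1) (n + 2))) a
  rw [ModuleCat.hom_comp, LinearMap.comp_apply, ModuleCat.hom_zero, LinearMap.zero_apply,
    inhomogeneousCochains.d_def, inhomogeneousCochains.d_def] at h
  exact h

/-- **Exactness at `Hⁿ(G, B)` without the connecting map: `Hⁿ(s)` is surjective when
`H^{n+1}(G, C) = 0`**, for `0 → C →t A →s B → 0` exact (`t` injective, `range t = ker s`,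
`s` surjective). [cite: Brown1982CohomologyGroups, III.6 Prop. 6.1] -/
theorem semimap_surjective_of_subsingleton (t : C.V →ₗ[k] A.V)
    (ht : ∀ (g : G) (c : C.V), t (C.ρ g c) = A.ρ g (t c)) (s : A.V →ₛₗ[σ] B.V)
    (hs : ∀ (g : G) (a : A.V), s (A.ρ g a) = B.ρ g (s a)) (htinj : Function.Injective t)
    (hexact : ∀ a, s a = 0 ↔ a ∈ LinearMap.range t) (hsurj : Function.Surjective s) (n : ℕ)
    [Subsingleton (groupCohomology C (n + 1))] :
    Function.Surjective (semimap s hs n) := by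
  intro y
  induction y using groupCohomology_induction_on with
  | h zB =>
    -- lift the cocycle of `B` to a cochain `a` of `A`
    choose lift hlift using hsurj
    let a : (inhomogeneousCochains A).X n := fun g => lift (iCocycles B n zB g)
    have ha : cochainsSemimap s n a = iCocycles B n zB := funext fun g => hlift _
    -- `s (da) = d (s a) = 0`, so `da = t c` for a cochain `c` of `C`
    have hsda : cochainsSemimap s (n + 1) (inhomogeneousCochains.d A n a) = 0 := by
      rw [← d_cochainsSemimap s hs, ha, d_iCocycles]
    have hval : ∀ g, ∃ c, t c = inhomogeneousCochains.d A n a g := fun g => by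
      have h0 : s (inhomogeneousCochains.d A n a g) = 0 := by
        have h1 := congrFun hsda g
        rwa [cochainsSemimap_apply] at h1
      obtain ⟨c, hc⟩ := (hexact _).1 h0
      exact ⟨c, hc⟩
    choose c hc using hval
    have htc : cochainsSemimap (σ := RingHom.id k) t (n + 1) c = inhomogeneousCochains.d A n a := funext hc
    -- `c` is a cocycle (`t` injective, `d d a = 0`)
    have hdc : inhomogeneousCochains.d C (n + 1) c = 0 := by
      have hinj : Function.Injective (cochainsSemimap (σ := RingHom.id k) (A := C) (B := A) t (n + 2)) :=
        fun f f' hff' => funext fun g => htinj (congrFun hff' g)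
      refine hinj ?_
      rw [← d_cochainsSemimap t ht, htc, inhomogeneousCochains_d_d_apply, map_zero]
    -- `H^{n+1}(C) = 0`: `c = d c'`
    obtain ⟨c', hc'⟩ := (π_apply_eq_zero_iff C (n + 1) (cocyclesMk c hdc)).1 (Subsingleton.elim _ _)
    have hc'' : toCocycles C n (n + 1) c' = cocyclesMk c hdc := hc'
    have hdc' : inhomogeneousCochains.d C n c' = c := by
      have h2 := iCocycles_toCocycles C n (n + 1) c'
      rw [hc'', iCocycles_mk, inhomogeneousCochains.d_def] at h2
      exact h2.symm
    -- the corrected lift `a' = a − t ∘ c'` is a cocycle mapping to `zB`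
    let a' : (inhomogeneousCochains A).X n := a - cochainsSemimap (σ := RingHom.id k) t n c'
    have hda' : inhomogeneousCochains.d A n a' = 0 := by
      change inhomogeneousCochains.d A n (a - cochainsSemimap (σ := RingHom.id k) t n c') = 0
      rw [map_sub, ← htc, d_cochainsSemimap t ht, hdc', sub_self]
    have hsa' : cochainsSemimap s n a' = iCocycles B n zB := by
      change cochainsSemimap s n (a - cochainsSemimap (σ := RingHom.id k) t n c') = _
      rw [map_sub, ha, sub_eq_self]
      funext g
      rw [cochainsSemimap_apply, cochainsSemimap_apply]
      exact (hexact _).2 ⟨c' g, rfl⟩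
    refine ⟨groupCohomology.π A n (cocyclesMk a' hda'), ?_⟩
    rw [semimap_π]
    congr 1
    refine iCocycles_injective B n ?_
    rw [iCocycles_cocyclesSemimap, iCocycles_mk, hsa']

/-- **`Hⁿ(G, A) → Hⁿ(G, A/ϖ)` is surjective when `H^{n+1}(G, A) = 0`** (`s` surjective with
`ker s = ϖ A`, `ϖ` injective on `A`). [cite: Brown1982CohomologyGroups, III.6 Prop. 6.1] [cite: Hida1994AIF, §3] -/
theorem semimap_smul_id_surjective_of_subsingleton (ϖ : k) (htf : ∀ a : A.V, ϖ • a = 0 → a = 0)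
    (s : A.V →ₛₗ[σ] B.V) (hs : ∀ (g : G) (a : A.V), s (A.ρ g a) = B.ρ g (s a))
    (hker : ∀ a, s a = 0 ↔ ∃ a', ϖ • a' = a) (hsurj : Function.Surjective s) (n : ℕ)
    [Subsingleton (groupCohomology A (n + 1))] :
    Function.Surjective (semimap s hs n) := by
  have htinj : Function.Injective (ϖ • LinearMap.id : A.V →ₗ[k] A.V) := by
    intro a b hab
    simp only [LinearMap.smul_apply, LinearMap.id_apply] at hab
    rw [← sub_eq_zero, ← smul_sub] at hab
    exact sub_eq_zero.1 (htf _ hab)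
  have hexact : ∀ a, s a = 0 ↔ a ∈ LinearMap.range (ϖ • LinearMap.id : A.V →ₗ[k] A.V) := fun a => by
    rw [hker, LinearMap.mem_range]
    rfl
  exact semimap_surjective_of_subsingleton (ϖ • LinearMap.id) (smul_id_equivariant ϖ) s hs htinj hexact hsurj n

end Literature.Algebra.Homology
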